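import Mathlib
import Literature.Computability.AlgebraicComplexity.PIProof
import Summits.ValiantsHypothesis.ValiantsHypothesis.Theorems.ProofCarryingSymmetryRestorationQPInvarianceProofCalculus

/-!
# Crux `RestorationQP` (stmt-ValiantsHypothesis-10343), line `registered`: the axiom-budget
calculus under stub S2 `stub_proofsToACInvariance` (and for every user of S3)

Stubs S2/S3 of the line meter `P_c(ℂ)`-provability (Hrubeš–Tzameret arXiv:1112.6265 §1.1) by
the AC BUDGET `ACB := fun s => if s ∈ {A6, A7, A8, A9, A10} then 0 else ⊤`: an invariance
identity `C ∘ σ = C` is `ACB`-provable (`HasPCProof _ _ ACB`) iff it has a `P_c` proof using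
only A1 (reflexivity), A2–A5 (commutativity/associativity of `+`, `·`), C1/C2 (unsharing) and
the rules R1–R4, of any size.  This file lands, once and for all, the bookkeeping every proof of
S2 and every user of S3 needs.

* `acBudget_add_le` (`ACB + ACB ≤ ACB`), `indicator_le_acBudget`: the budget arithmetic making
  `ACB`-provability closed under R1–R4 (`acb_refl/symm/trans/add/mul`) and containing A2–A5
  (`acb_add_comm/add_assoc/mul_comm/mul_assoc`).
* `acb_rename_smul_mul`, `acb_rename_one_smul`, `acb_rename_smul_of_mclosure_eq_top`: for a FIXED
  circuit the `σ` with `ACB`-provable `C ∘ σ = C` form a submonoid, so generators suffice;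
  registered rungs B1 `proofsToACInvariance_aux_acBudget_mul` (products) and
  B2 `proofsToACInvariance_aux_acBudget_of_adjacent` (adjacent transpositions give all of
  `S_{n+1}`, `Equiv.Perm.mclosure_swap_castSucc_succ`).
* Degenerate instances of S2 with `c = 1`, `C' = C` or `C' = const a`: `n ≤ 1`
  (`proofsToACInvariance_of_le_one`) and constant `Ĉ` (`proofsToACInvariance_of_eval_eq_C`).
* `acb_foldr_add_perm` (sums over permuted lists are `ACB`-equal) and the ORBIT SUM
  `(1/|G|) · Σ_g C ∘ g`, whose invariance identities are `ACB`-provable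
  (`acb_rename_orbitSum`): hence S2 holds QUALITATIVELY and for each FIXED `n`
  (`proofsToACInvariance_allPerm`, size `n!(|C|+1)+3`; `proofsToACInvariance_fixed_n`,
  `c = n + 2`) — exactly as for S3/L (`…RestorationQPFixedN`), only the uniformity of the exponent
  `c` in `n` is at stake in S2; no degenerate case refutes it.
-/

-- single-problem summit: `Summit.ValiantsHypothesis.ValiantsHypothesis.…` is the namespace by design (D-0017)
set_option linter.dupNamespace false

namespace Summit.ValiantsHypothesis.ValiantsHypothesis.Theorems

open MvPolynomial Literature.Computability.AlgebraicComplexity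

universe u v w

-- `ACB` in the prose below is the AC budget of stubs S2/S3, always written out literally:
-- `fun s => if s = PIAxiom.A6 ∨ s = PIAxiom.A7 ∨ s = PIAxiom.A8 ∨ s = PIAxiom.A9 ∨ s = PIAxiom.A10 then 0 else ⊤`.

/-! ### Budget arithmetic -/

/-- The AC budget is idempotent, `ACB + ACB ≤ ACB` pointwise (`0 + 0 = 0`, `⊤ + ⊤ = ⊤`): rules
R2–R4 add the axiom counts of the proofs they combine, and stay within the budget. [folklore] -/
theorem acBudget_add_le : ∀ s : PIAxiom, (fun s => if s = PIAxiom.A6 ∨ s = PIAxiom.A7 ∨ s = PIAxiom.A8 ∨ s = PIAxiom.A9 ∨ s = PIAxiom.A10 then (0 : ℕ∞) else ⊤) s + (fun s => if s = PIAxiom.A6 ∨ s = PIAxiom.A7 ∨ s = PIAxiom.A8 ∨ s = PIAxiom.A9 ∨ s = PIAxiom.A10 then (0 : ℕ∞) else ⊤) s ≤ (fun s => if s = PIAxiom.A6 ∨ s = PIAxiom.A7 ∨ s = PIAxiom.A8 ∨ s = PIAxiom.A9 ∨ s = PIAxiom.A10 then (0 : ℕ∞) else ⊤) s := by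
  intro s
  dsimp only
  split_ifs <;> simp

/-- One instance of a scheme other than A6–A10 (i.e. of A1–A5, C1, C2) is within the AC budget.
[folklore] -/
theorem indicator_le_acBudget (a : PIAxiom)
    (ha : ¬ (a = PIAxiom.A6 ∨ a = PIAxiom.A7 ∨ a = PIAxiom.A8 ∨ a = PIAxiom.A9 ∨ a = PIAxiom.A10)) :
    ∀ s : PIAxiom, (if a = s then (1 : ℕ∞) else 0) ≤ (fun s => if s = PIAxiom.A6 ∨ s = PIAxiom.A7 ∨ s = PIAxiom.A8 ∨ s = PIAxiom.A9 ∨ s = PIAxiom.A10 then (0 : ℕ∞) else ⊤) s := by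
  intro s
  dsimp only
  split_ifs with h₁ h₂
  · subst h₁; exact absurd h₂ ha
  · exact le_top
  · simp
  · simp

/-! ### `ACB`-provability is closed under the rules and contains A1–A5 -/

section Calculus

variable {𝔽 : Type u} [CommSemiring 𝔽] {X : Type v} {Y : Type w}

/-- A1 within the AC budget. [folklore] -/
theorem acb_refl (F : PICircuit 𝔽 X) : HasPCProof F F (fun s => if s = PIAxiom.A6 ∨ s = PIAxiom.A7 ∨ s = PIAxiom.A8 ∨ s = PIAxiom.A9 ∨ s = PIAxiom.A10 then (0 : ℕ∞) else ⊤) :=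
  PISystem.Provable.mono (PISystem.Provable.refl (S := pcSystem 𝔽 X) F) le_top
    (indicator_le_acBudget .A1 (by decide))

/-- R1 within the AC budget. [folklore] -/
theorem acb_symm {F G : PICircuit 𝔽 X} (h : HasPCProof F G (fun s => if s = PIAxiom.A6 ∨ s = PIAxiom.A7 ∨ s = PIAxiom.A8 ∨ s = PIAxiom.A9 ∨ s = PIAxiom.A10 then (0 : ℕ∞) else ⊤)) : HasPCProof G F (fun s => if s = PIAxiom.A6 ∨ s = PIAxiom.A7 ∨ s = PIAxiom.A8 ∨ s = PIAxiom.A9 ∨ s = PIAxiom.A10 then (0 : ℕ∞) else ⊤) :=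
  PISystem.Provable.mono (PISystem.Provable.symm h) le_top fun _ => le_rfl

/-- R2 within the AC budget (axiom counts add, `ACB + ACB ≤ ACB`). [folklore] -/
theorem acb_trans {F G H : PICircuit 𝔽 X} (h₁ : HasPCProof F G (fun s => if s = PIAxiom.A6 ∨ s = PIAxiom.A7 ∨ s = PIAxiom.A8 ∨ s = PIAxiom.A9 ∨ s = PIAxiom.A10 then (0 : ℕ∞) else ⊤)) (h₂ : HasPCProof G H (fun s => if s = PIAxiom.A6 ∨ s = PIAxiom.A7 ∨ s = PIAxiom.A8 ∨ s = PIAxiom.A9 ∨ s = PIAxiom.A10 then (0 : ℕ∞) else ⊤)) :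
    HasPCProof F H (fun s => if s = PIAxiom.A6 ∨ s = PIAxiom.A7 ∨ s = PIAxiom.A8 ∨ s = PIAxiom.A9 ∨ s = PIAxiom.A10 then (0 : ℕ∞) else ⊤) :=
  PISystem.Provable.mono (PISystem.Provable.trans h₁ h₂) le_top acBudget_add_le

/-- R3 within the AC budget. [folklore] -/
theorem acb_add {F₁ G₁ F₂ G₂ : PICircuit 𝔽 X} (h₁ : HasPCProof F₁ G₁ (fun s => if s = PIAxiom.A6 ∨ s = PIAxiom.A7 ∨ s = PIAxiom.A8 ∨ s = PIAxiom.A9 ∨ s = PIAxiom.A10 then (0 : ℕ∞) else ⊤))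
    (h₂ : HasPCProof F₂ G₂ (fun s => if s = PIAxiom.A6 ∨ s = PIAxiom.A7 ∨ s = PIAxiom.A8 ∨ s = PIAxiom.A9 ∨ s = PIAxiom.A10 then (0 : ℕ∞) else ⊤)) : HasPCProof (F₁.add F₂) (G₁.add G₂) (fun s => if s = PIAxiom.A6 ∨ s = PIAxiom.A7 ∨ s = PIAxiom.A8 ∨ s = PIAxiom.A9 ∨ s = PIAxiom.A10 then (0 : ℕ∞) else ⊤) :=
  PISystem.Provable.mono (PISystem.Provable.add h₁ h₂) le_top acBudget_add_le

/-- R4 within the AC budget. [folklore] -/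
theorem acb_mul {F₁ G₁ F₂ G₂ : PICircuit 𝔽 X} (h₁ : HasPCProof F₁ G₁ (fun s => if s = PIAxiom.A6 ∨ s = PIAxiom.A7 ∨ s = PIAxiom.A8 ∨ s = PIAxiom.A9 ∨ s = PIAxiom.A10 then (0 : ℕ∞) else ⊤))
    (h₂ : HasPCProof F₂ G₂ (fun s => if s = PIAxiom.A6 ∨ s = PIAxiom.A7 ∨ s = PIAxiom.A8 ∨ s = PIAxiom.A9 ∨ s = PIAxiom.A10 then (0 : ℕ∞) else ⊤)) : HasPCProof (F₁.mul F₂) (G₁.mul G₂) (fun s => if s = PIAxiom.A6 ∨ s = PIAxiom.A7 ∨ s = PIAxiom.A8 ∨ s = PIAxiom.A9 ∨ s = PIAxiom.A10 then (0 : ℕ∞) else ⊤) :=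
  PISystem.Provable.mono (PISystem.Provable.mul h₁ h₂) le_top acBudget_add_le

/-- A2 within the AC budget: `F + G = G + F`. [folklore] -/
theorem acb_add_comm (F G : PICircuit 𝔽 X) : HasPCProof (F.add G) (G.add F) (fun s => if s = PIAxiom.A6 ∨ s = PIAxiom.A7 ∨ s = PIAxiom.A8 ∨ s = PIAxiom.A9 ∨ s = PIAxiom.A10 then (0 : ℕ∞) else ⊤) :=
  PISystem.Provable.mono (PISystem.Provable.of_isAxiom (S := pcSystem 𝔽 X) (.inl (.a2 F G)))
    le_top (indicator_le_acBudget .A2 (by decide))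

/-- A3 within the AC budget: `F + (G + H) = (F + G) + H`. [folklore] -/
theorem acb_add_assoc (F G H : PICircuit 𝔽 X) :
    HasPCProof (F.add (G.add H)) ((F.add G).add H) (fun s => if s = PIAxiom.A6 ∨ s = PIAxiom.A7 ∨ s = PIAxiom.A8 ∨ s = PIAxiom.A9 ∨ s = PIAxiom.A10 then (0 : ℕ∞) else ⊤) :=
  PISystem.Provable.mono (PISystem.Provable.of_isAxiom (S := pcSystem 𝔽 X) (.inl (.a3 F G H)))
    le_top (indicator_le_acBudget .A3 (by decide))

/-- A4 within the AC budget: `F · G = G · F`. [folklore] -/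
theorem acb_mul_comm (F G : PICircuit 𝔽 X) : HasPCProof (F.mul G) (G.mul F) (fun s => if s = PIAxiom.A6 ∨ s = PIAxiom.A7 ∨ s = PIAxiom.A8 ∨ s = PIAxiom.A9 ∨ s = PIAxiom.A10 then (0 : ℕ∞) else ⊤) :=
  PISystem.Provable.mono (PISystem.Provable.of_isAxiom (S := pcSystem 𝔽 X) (.inl (.a4 F G)))
    le_top (indicator_le_acBudget .A4 (by decide))

/-- A5 within the AC budget: `F · (G · H) = (F · G) · H`. [folklore] -/
theorem acb_mul_assoc (F G H : PICircuit 𝔽 X) :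
    HasPCProof (F.mul (G.mul H)) ((F.mul G).mul H) (fun s => if s = PIAxiom.A6 ∨ s = PIAxiom.A7 ∨ s = PIAxiom.A8 ∨ s = PIAxiom.A9 ∨ s = PIAxiom.A10 then (0 : ℕ∞) else ⊤) :=
  PISystem.Provable.mono (PISystem.Provable.of_isAxiom (S := pcSystem 𝔽 X) (.inl (.a5 F G H)))
    le_top (indicator_le_acBudget .A5 (by decide))

/-- LITERAL invariance is `ACB`-provable invariance (one instance of A1). [folklore] -/
theorem acb_of_rename_eq {f : X → X} (C : PICircuit 𝔽 X) (h : C.rename f = C) :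
    HasPCProof (C.rename f) C (fun s => if s = PIAxiom.A6 ∨ s = PIAxiom.A7 ∨ s = PIAxiom.A8 ∨ s = PIAxiom.A9 ∨ s = PIAxiom.A10 then (0 : ℕ∞) else ⊤) := by
  rw [h]; exact acb_refl C

/-! ### For a fixed circuit, the `ACB`-provable invariance identities form a submonoid -/

variable {M : Type*} [Monoid M] [MulAction M X]

/-- **Products.** From `ACB`-proofs of `C ∘ g = C` and `C ∘ h = C`: renaming the second along
`g` (`P_c` proofs are closed under renaming, with the same axiom counts) gives
`C ∘ (g h) = C ∘ g`, and R2 chains it with the first. [folklore] -/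
theorem acb_rename_smul_mul (C : PICircuit 𝔽 X) {g h : M}
    (hg : HasPCProof (C.rename fun x : X => g • x) C (fun s => if s = PIAxiom.A6 ∨ s = PIAxiom.A7 ∨ s = PIAxiom.A8 ∨ s = PIAxiom.A9 ∨ s = PIAxiom.A10 then (0 : ℕ∞) else ⊤))
    (hh : HasPCProof (C.rename fun x : X => h • x) C (fun s => if s = PIAxiom.A6 ∨ s = PIAxiom.A7 ∨ s = PIAxiom.A8 ∨ s = PIAxiom.A9 ∨ s = PIAxiom.A10 then (0 : ℕ∞) else ⊤)) :
    HasPCProof (C.rename fun x : X => (g * h) • x) C (fun s => if s = PIAxiom.A6 ∨ s = PIAxiom.A7 ∨ s = PIAxiom.A8 ∨ s = PIAxiom.A9 ∨ s = PIAxiom.A10 then (0 : ℕ∞) else ⊤) := by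
  have hh' := hh.rename fun x : X => g • x
  rw [piCircuit_rename_rename] at hh'
  have hcomp : ((fun x : X => g • x) ∘ fun x : X => h • x) = fun x : X => (g * h) • x :=
    funext fun x => (mul_smul g h x).symm
  rw [hcomp] at hh'
  exact acb_trans hh' hg

/-- **Unit.** `C ∘ 1 = C` is, literally, `C = C` (A1). [folklore] -/
theorem acb_rename_one_smul (C : PICircuit 𝔽 X) :
    HasPCProof (C.rename fun x : X => (1 : M) • x) C (fun s => if s = PIAxiom.A6 ∨ s = PIAxiom.A7 ∨ s = PIAxiom.A8 ∨ s = PIAxiom.A9 ∨ s = PIAxiom.A10 then (0 : ℕ∞) else ⊤) := by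
  have h1 : (fun x : X => (1 : M) • x) = id := funext fun x => one_smul M x
  rw [h1, piCircuit_rename_id]
  exact acb_refl C

/-- **Generators suffice.** If `C ∘ g = C` is `ACB`-provable for every `g` in a generating set of
a monoid acting on the variables, it is `ACB`-provable for every element of the monoid.
[folklore] -/
theorem acb_rename_smul_of_mclosure_eq_top (S : Set M) (hS : Submonoid.closure S = ⊤)
    (C : PICircuit 𝔽 X) (h : ∀ g ∈ S, HasPCProof (C.rename fun x : X => g • x) C (fun s => if s = PIAxiom.A6 ∨ s = PIAxiom.A7 ∨ s = PIAxiom.A8 ∨ s = PIAxiom.A9 ∨ s = PIAxiom.A10 then (0 : ℕ∞) else ⊤)) (m : M) :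
    HasPCProof (C.rename fun x : X => m • x) C (fun s => if s = PIAxiom.A6 ∨ s = PIAxiom.A7 ∨ s = PIAxiom.A8 ∨ s = PIAxiom.A9 ∨ s = PIAxiom.A10 then (0 : ℕ∞) else ⊤) := by
  let H : Submonoid M :=
    { carrier := {m | HasPCProof (C.rename fun x : X => m • x) C (fun s => if s = PIAxiom.A6 ∨ s = PIAxiom.A7 ∨ s = PIAxiom.A8 ∨ s = PIAxiom.A9 ∨ s = PIAxiom.A10 then (0 : ℕ∞) else ⊤)}
      one_mem' := acb_rename_one_smul C
      mul_mem' := fun ha hb => acb_rename_smul_mul C ha hb }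
  have hle : Submonoid.closure S ≤ H := Submonoid.closure_le.2 fun g hg => h g hg
  exact hle (hS ▸ Submonoid.mem_top m)

end Calculus

/-! ### The registered rungs B1, B2 -/

/-- **B1 — products** (registered helper of S2): `ACB`-proofs of `C ∘ σ = C` and `C ∘ τ = C`
give one of `C ∘ (σ τ) = C`. [folklore] -/
theorem proofsToACInvariance_aux_acBudget_mul : ∀ (n : ℕ) (C : PICircuit ℂ (Fin n × Fin n)) (σ τ : Equiv.Perm (Fin n)), HasPCProof (C.rename fun x : Fin n × Fin n => σ • x) C (fun s => if s = PIAxiom.A6 ∨ s = PIAxiom.A7 ∨ s = PIAxiom.A8 ∨ s = PIAxiom.A9 ∨ s = PIAxiom.A10 then 0 else ⊤) → HasPCProof (C.rename fun x : Fin n × Fin n => τ • x) C (fun s => if s = PIAxiom.A6 ∨ s = PIAxiom.A7 ∨ s = PIAxiom.A8 ∨ s = PIAxiom.A9 ∨ s = PIAxiom.A10 then 0 else ⊤) → HasPCProof (C.rename fun x : Fin n × Fin n => (σ * τ) • x) C (fun s => if s = PIAxiom.A6 ∨ s = PIAxiom.A7 ∨ s = PIAxiom.A8 ∨ s = PIAxiom.A9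 ∨ s = PIAxiom.A10 then 0 else ⊤) :=
  fun _ C _ _ hσ hτ => acb_rename_smul_mul C hσ hτ

/-- **B2 — adjacent transpositions suffice** (registered helper of S2): `ACB`-proofs of
`C ∘ (i i+1) = C` for the `n` adjacent transpositions of `Fin (n + 1)` give `ACB`-proofs of
`C ∘ σ = C` for every `σ ∈ S_{n+1}` (`Equiv.Perm.mclosure_swap_castSucc_succ`). [folklore] -/
theorem proofsToACInvariance_aux_acBudget_of_adjacent : ∀ (n : ℕ) (C : PICircuit ℂ (Fin (n + 1) × Fin (n + 1))), (∀ i : Fin n, HasPCProof (C.rename fun x : Fin (n + 1) × Fin (n + 1) => (Equiv.swap i.castSucc i.succ) • x) C (fun s => if s = PIAxiom.A6 ∨ s = PIAxiom.A7 ∨ s = PIAxiom.A8 ∨ s = PIAxiom.A9 ∨ s = PIAxiom.A10 then 0 else ⊤)) → ∀ σ : Equiv.Perm (Fin (n + 1)), HasPCProof (C.rename fun x : Fin (n + 1) × Fin (n + 1) => σ • x) C (fun s => if s = PIAxiom.A6 ∨ s = PIAxiom.A7 ∨ s = PIAxiom.A8 ∨ s = PIAxiom.A9 ∨ s = PIAxiom.A10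 then 0 else ⊤) := by
  intro n C h σ
  refine acb_rename_smul_of_mclosure_eq_top _ (Equiv.Perm.mclosure_swap_castSucc_succ n) C ?_ σ
  rintro _ ⟨i, rfl⟩
  exact h i

/-- B2 for `Fin n`, any `n`, with the adjacent transpositions written `(i j)`, `j = i + 1` (the
phrasing of `hasPCProofOfSize_rename_perm_of_adjacent`). [folklore] -/
theorem acb_rename_perm_of_adjacent {n : ℕ} (C : PICircuit ℂ (Fin n × Fin n))
    (h : ∀ i j : Fin n, (j : ℕ) = i + 1 →
      HasPCProof (C.rename fun x : Fin n × Fin n => Equiv.swap i j • x) C (fun s => if s = PIAxiom.A6 ∨ s = PIAxiom.A7 ∨ s = PIAxiom.A8 ∨ s = PIAxiom.A9 ∨ s = PIAxiom.A10 then (0 : ℕ∞) else ⊤))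
    (σ : Equiv.Perm (Fin n)) : HasPCProof (C.rename fun x : Fin n × Fin n => σ • x) C (fun s => if s = PIAxiom.A6 ∨ s = PIAxiom.A7 ∨ s = PIAxiom.A8 ∨ s = PIAxiom.A9 ∨ s = PIAxiom.A10 then (0 : ℕ∞) else ⊤) := by
  cases n with
  | zero =>
    have hσ : σ = 1 := Subsingleton.elim _ _
    subst hσ
    exact acb_rename_one_smul C
  | succ m =>
    exact proofsToACInvariance_aux_acBudget_of_adjacent m C (fun i => h i.castSucc i.succ (by simp)) σ

/-! ### Degenerate instances of S2 (`c = 1`) -/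

/-- S2 for `n ≤ 1` with `C' = C`, `c = 1`: `S_n` is trivial and `C ∘ 1 = C` is A1. [folklore] -/
theorem proofsToACInvariance_of_le_one : ∀ (n t : ℕ) (C : PICircuit ℂ (Fin n × Fin n)), n ≤ 1 →
    ∃ C' : PICircuit ℂ (Fin n × Fin n), C'.eval = C.eval ∧ C'.size ≤ (C.size + t + n + 2) ^ 1 ∧
      ∀ σ : Equiv.Perm (Fin n), HasPCProof (C'.rename fun x : Fin n × Fin n => σ • x) C' (fun s => if s = PIAxiom.A6 ∨ s = PIAxiom.A7 ∨ s = PIAxiom.A8 ∨ s = PIAxiom.A9 ∨ s = PIAxiom.A10 then (0 : ℕ∞) else ⊤) := by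
  intro n t C hn
  refine ⟨C, rfl, by rw [pow_one]; omega, fun σ => ?_⟩
  haveI : Subsingleton (Fin n) := ⟨fun a b => Fin.ext (by omega)⟩
  have hσ : σ = 1 := Subsingleton.elim _ _
  subst hσ
  exact acb_rename_one_smul C

/-- S2 for constant `Ĉ = a` with `C' = a` (one node), `c = 1`: `a ∘ σ = a` literally. [folklore] -/
theorem proofsToACInvariance_of_eval_eq_C : ∀ (n t : ℕ) (C : PICircuit ℂ (Fin n × Fin n)) (a : ℂ),
    C.eval = MvPolynomial.C a →
    ∃ C' : PICircuit ℂ (Fin n × Fin n), C'.eval = C.eval ∧ C'.size ≤ (C.size + t + n + 2) ^ 1 ∧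
      ∀ σ : Equiv.Perm (Fin n), HasPCProof (C'.rename fun x : Fin n × Fin n => σ • x) C' (fun s => if s = PIAxiom.A6 ∨ s = PIAxiom.A7 ∨ s = PIAxiom.A8 ∨ s = PIAxiom.A9 ∨ s = PIAxiom.A10 then (0 : ℕ∞) else ⊤) := by
  intro n t C a ha
  refine ⟨PICircuit.const a, by rw [PICircuit.eval_const, ha], ?_, fun σ => acb_of_rename_eq _ rfl⟩
  rw [PICircuit.size_const, pow_one]
  omega

/-! ### Sums over permuted lists; the orbit sum -/

section OrbitSum

variable {𝔽 : Type u} [CommSemiring 𝔽] {X : Type v} {Y : Type w}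

/-- List sums `F₁ + (F₂ + (⋯ + 0))` over lists which are permutations of each other are
`ACB`-provably equal: A2, A3 under R3 along the adjacent transpositions sorting one list into the
other. [folklore] -/
theorem acb_foldr_add_perm {l₁ l₂ : List (PICircuit 𝔽 X)} (h : l₁.Perm l₂) :
    HasPCProof (l₁.foldr PICircuit.add (PICircuit.const 0))
      (l₂.foldr PICircuit.add (PICircuit.const 0)) (fun s => if s = PIAxiom.A6 ∨ s = PIAxiom.A7 ∨ s = PIAxiom.A8 ∨ s = PIAxiom.A9 ∨ s = PIAxiom.A10 then (0 : ℕ∞) else ⊤) := by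
  induction h with
  | nil => exact acb_refl _
  | cons a _ ih => exact acb_add (acb_refl a) ih
  | swap a b l =>
    simp only [List.foldr_cons]
    exact acb_trans (acb_add_assoc b a _)
      (acb_trans (acb_add (acb_add_comm b a) (acb_refl _)) (acb_symm (acb_add_assoc a b _)))
  | trans _ _ ih₁ ih₂ => exact acb_trans ih₁ ih₂

/-- Renaming distributes over list sums. [folklore] -/
theorem piCircuit_rename_foldr_add (f : X → Y) (l : List (PICircuit 𝔽 X)) :
    (l.foldr PICircuit.add (PICircuit.const 0)).rename f =
      (l.map (PICircuit.rename f)).foldr PICircuit.add (PICircuit.const 0) := by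
  induction l with
  | nil => rfl
  | cons a l ih => rw [List.foldr_cons, List.map_cons, List.foldr_cons, PICircuit.rename_add, ih]

/-- A list sum computes the sum. [folklore] -/
theorem piCircuit_eval_foldr_add (l : List (PICircuit 𝔽 X)) :
    (l.foldr PICircuit.add (PICircuit.const 0)).eval = (l.map PICircuit.eval).sum := by
  induction l with
  | nil => simp
  | cons a l ih => simp [ih]

/-- A list sum of `k` circuits of size `≤ s` has size `≤ k (s + 1) + 1`. [folklore] -/
theorem piCircuit_size_foldr_add_le (l : List (PICircuit 𝔽 X)) (s : ℕ) (hl : ∀ F ∈ l, F.size ≤ s) :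
    (l.foldr PICircuit.add (PICircuit.const 0)).size ≤ l.length * (s + 1) + 1 := by
  induction l with
  | nil => simp
  | cons a l ih =>
    have ha := hl a (by simp)
    have ih' := ih fun F hF => hl F (by simp [hF])
    simp only [List.foldr_cons, PICircuit.size_add, List.length_cons]
    nlinarith [ha, ih']

variable {G : Type*} [Group G] [Fintype G] [MulAction G X]

/-- **The orbit sum is `ACB`-invariant.** For `k · Σ_{g ∈ G} (C ∘ g)` (list sum over an
enumeration of the finite group `G` acting on the variables), renaming along `h ∈ G` maps the
summand `C ∘ g` literally to the summand `C ∘ (h g)`, i.e. PERMUTES the summands; so the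
invariance identity is provable from A1–A3 and R2–R4 alone. [folklore] -/
theorem acb_rename_orbitSum (k : 𝔽) (C : PICircuit 𝔽 X) (h : G) :
    HasPCProof
      (((PICircuit.const k).mul ((((Finset.univ : Finset G).toList.map fun g : G =>
        C.rename fun x : X => g • x)).foldr PICircuit.add (PICircuit.const 0))).rename
          fun x : X => h • x)
      ((PICircuit.const k).mul ((((Finset.univ : Finset G).toList.map fun g : G =>
        C.rename fun x : X => g • x)).foldr PICircuit.add (PICircuit.const 0))) (fun s => if s = PIAxiom.A6 ∨ s = PIAxiom.A7 ∨ s = PIAxiom.A8 ∨ s = PIAxiom.A9 ∨ s = PIAxiom.A10 then (0 : ℕ∞) else ⊤) := by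
  rw [PICircuit.rename_mul, piCircuit_rename_foldr_add, List.map_map]
  have hcomp : (PICircuit.rename (fun x : X => h • x) ∘ fun g : G => C.rename fun x : X => g • x) =
      (fun g : G => C.rename fun x : X => g • x) ∘ fun g : G => h * g := by
    funext g
    simp only [Function.comp_apply, piCircuit_rename_rename]
    congr 1
    funext x
    exact (mul_smul h g x).symm
  rw [hcomp, ← List.map_map]
  have hperm : ((Finset.univ : Finset G).toList.map fun g : G => h * g).Perm
      (Finset.univ : Finset G).toList := by
    rw [List.perm_ext_iff_of_nodup ((Finset.nodup_toList _).map (mul_right_injective h))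
      (Finset.nodup_toList _)]
    intro g
    simp only [List.mem_map, Finset.mem_toList, Finset.mem_univ, true_and, iff_true]
    exact ⟨h⁻¹ * g, mul_inv_cancel_left h g⟩
  exact acb_mul (acb_of_rename_eq _ rfl) (acb_foldr_add_perm (hperm.map _))

end OrbitSum

/-! ### S2 holds qualitatively, and for each fixed `n` -/

/-- **S2 without the size bound.** If `Ĉ` is `S_n`-invariant (which the hypothesis of S2 gives
by soundness of `P_c`), the orbit average `C' = (1/n!) · Σ_σ (C ∘ σ)` computes `Ĉ`, has size
`n! (|C| + 1) + 3`, and ALL its invariance identities are `ACB`-provable: the conclusion of S2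
never fails outright, only its size bound is at stake. [folklore] -/
theorem proofsToACInvariance_allPerm : ∀ (n : ℕ) (C : PICircuit ℂ (Fin n × Fin n)),
    (∀ σ : Equiv.Perm (Fin n),
      MvPolynomial.rename (fun x : Fin n × Fin n => σ • x) C.eval = C.eval) →
    ∃ C' : PICircuit ℂ (Fin n × Fin n), C'.eval = C.eval ∧
      C'.size ≤ n.factorial * (C.size + 1) + 3 ∧
      ∀ σ : Equiv.Perm (Fin n), HasPCProof (C'.rename fun x : Fin n × Fin n => σ • x) C' (fun s => if s = PIAxiom.A6 ∨ s = PIAxiom.A7 ∨ s = PIAxiom.A8 ∨ s = PIAxiom.A9 ∨ s = PIAxiom.A10 then (0 : ℕ∞) else ⊤) := by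
  intro n C hC
  refine ⟨(PICircuit.const ((n.factorial : ℂ)⁻¹)).mul
    ((((Finset.univ : Finset (Equiv.Perm (Fin n))).toList.map fun g : Equiv.Perm (Fin n) =>
      C.rename fun x : Fin n × Fin n => g • x)).foldr PICircuit.add (PICircuit.const 0)),
    ?_, ?_, fun σ => acb_rename_orbitSum _ C σ⟩
  · rw [PICircuit.eval_mul, PICircuit.eval_const, piCircuit_eval_foldr_add, List.map_map]
    have hc : (PICircuit.eval ∘ fun g : Equiv.Perm (Fin n) => C.rename fun x : Fin n × Fin n => g • x) =
        fun _ => C.eval := by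
      funext g
      simp only [Function.comp_apply, PICircuit.eval_rename, hC]
    rw [hc, List.map_const', List.sum_replicate, Finset.length_toList, Finset.card_univ,
      Fintype.card_perm, Fintype.card_fin, nsmul_eq_mul, ← mul_assoc, ← MvPolynomial.C_eq_coe_nat,
      ← map_mul, inv_mul_cancel₀ (by exact_mod_cast Nat.factorial_ne_zero n), map_one, one_mul]
  · rw [PICircuit.size_mul, PICircuit.size_const]
    have := piCircuit_size_foldr_add_le
      (((Finset.univ : Finset (Equiv.Perm (Fin n))).toList.map fun g : Equiv.Perm (Fin n) =>
        C.rename fun x : Fin n × Fin n => g • x)) C.size (by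
        intro F hF
        obtain ⟨g, -, rfl⟩ := List.mem_map.1 hF
        rw [PICircuit.size_rename])
    rw [List.length_map, Finset.length_toList, Finset.card_univ, Fintype.card_perm,
      Fintype.card_fin] at this
    omega

/-- **The `∀ n, ∃ c` form of S2 holds** (`c = n + 2`): for each FIXED `n`, size-`t` proofs of all
invariance identities of `C` (indeed, mere `S_n`-invariance of `Ĉ`) give a circuit `C'` for `Ĉ`
of size `≤ (|C| + t + n + 2)^(n+2)` all of whose invariance identities are `ACB`-provable.  The
registered stub S2 asks for `c` uniform in `n`. [folklore] -/
theorem proofsToACInvariance_fixed_n (n : ℕ) : ∃ c : ℕ, ∀ (t : ℕ) (C : PICircuit ℂ (Fin n × Fin n)),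
    (∀ σ : Equiv.Perm (Fin n), HasPCProofOfSize (C.rename fun x : Fin n × Fin n => σ • x) C t) →
    ∃ C' : PICircuit ℂ (Fin n × Fin n), C'.eval = C.eval ∧ C'.size ≤ (C.size + t + n + 2) ^ c ∧
      ∀ σ : Equiv.Perm (Fin n), HasPCProof (C'.rename fun x : Fin n × Fin n => σ • x) C' (fun s => if s = PIAxiom.A6 ∨ s = PIAxiom.A7 ∨ s = PIAxiom.A8 ∨ s = PIAxiom.A9 ∨ s = PIAxiom.A10 then (0 : ℕ∞) else ⊤) := by
  refine ⟨n + 2, fun t C h => ?_⟩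
  obtain ⟨C', hev, hsize, hpf⟩ := proofsToACInvariance_allPerm n C fun σ => by
    have := (h σ).eval_eq
    rwa [PICircuit.eval_rename] at this
  refine ⟨C', hev, hsize.trans ?_, hpf⟩
  set m : ℕ := C.size + t + n + 2 with hm
  have h1s : 1 ≤ C.size := C.one_le_size
  have hfac : n.factorial ≤ m ^ n :=
    (Nat.factorial_le_pow n).trans (Nat.pow_le_pow_left (by omega) n)
  have hs1 : C.size + 1 ≤ m := by omega
  have h3 : 3 ≤ m := by omega
  have hA : n.factorial * (C.size + 1) ≤ m ^ n * m := Nat.mul_le_mul hfac hs1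
  have hmn : 1 ≤ m ^ n := Nat.one_le_pow _ _ (by omega)
  calc n.factorial * (C.size + 1) + 3 ≤ m ^ n * m + m := by omega
    _ ≤ m ^ n * m + m ^ n * m := by nlinarith
    _ = 2 * m ^ (n + 1) := by ring
    _ ≤ m * m ^ (n + 1) := Nat.mul_le_mul_right _ (by omega)
    _ = m ^ (n + 2) := by ring

/-! ### Glue for the junk-free (unfolded) form of the interface -/

/-- `toCircuit` commutes with renaming. [folklore] -/
theorem piFormula_toCircuit_rename {𝔽 : Type u} {X : Type v} {Y : Type w} (f : X → Y)
    (F : PIFormula 𝔽 X) : (F.rename f).toCircuit = F.toCircuit.rename f := by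
  induction F with
  | var x => rfl
  | const c => rfl
  | add F G ihF ihG =>
    simp only [PIFormula.rename, PIFormula.toCircuit, ihF, ihG, PICircuit.rename_add]
  | mul F G ihF ihG =>
    simp only [PIFormula.rename, PIFormula.toCircuit, ihF, ihG, PICircuit.rename_mul]

/-- The unfolded-and-reread circuit `(C•)` of a renamed circuit is the renamed `(C•)`: so every
rung of this file applies verbatim to the tree circuits `C.unfold.toCircuit` (no dead nodes, no
sharing), on which `ACB`-provability is exactly AC-equivalence of the unfoldings. [folklore] -/
theorem piCircuit_unfold_toCircuit_rename {𝔽 : Type u} [Zero 𝔽] {X : Type v} {Y : Type w}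
    (f : X → Y) (C : PICircuit 𝔽 X) :
    (C.rename f).unfold.toCircuit = C.unfold.toCircuit.rename f := by
  rw [PICircuit.unfold_rename, piFormula_toCircuit_rename]

end Summit.ValiantsHypothesis.ValiantsHypothesis.Theorems
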